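import Summits.BirchSwinnertonDyer.BirchSwinnertonDyer.Theorems.GenusKolyvaginAtTwoGenusDeepSupplyAtTwoNegDiscNarrowKFourCellHalvingDescent
import Summits.BirchSwinnertonDyer.BirchSwinnertonDyer.Theorems.GenusKolyvaginAtTwoSupplyKernelsLossless
import HarnessLib

/-!
# Route `GenusKolyvaginAtTwo`, crux K₄ `K4Neg` (stmt-BirchSwinnertonDyer-31526; Δ<0 twin of K₄⁺ 31469) — THE HALVING DESCENT «B2Q♭» FOR K4Neg
# WITH ITS PRIME CLAUSE VERBATIM (`FrobEqFrobInfty`): K4Neg ⟸ one Selmer class of order `2^{M₀}` over `ℚ`; DEPTH ONE is a theorem mod Q2;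
# K4Neg is LOSSLESS on the cut

Width seat `bsd-line-gk2-p5` g36 (cell `bsd-f1-sign2`), `--supports stmt-BirchSwinnertonDyer-31526 --as helper`.  THEOREMS ONLY (no definition,
no named fact, no `sorry`).  **BSD is NOT proved by this file; K4Neg is NOT proved (all depths); nothing is closed.**

The K₄⁺ files (`…PosDiscShallowKFourPosHalvingDescent{,Corollaries}`, `…KFourPosLossless`) with the prime clause of K4Neg: on `Δ < 0` the regular
signed pair-Čebotarev is gk2-p2's `FrobEqFrobInfty` pair Čebotarev (`infinite_kolyvaginPrime_localization_fullOrder_pair`: `h = c₀` on `E[2^{n+1}]`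
and on `K`), so the prime returned by the prime-clause-generic core (`…KFourCellHalvingDescent`) carries `FrobEqFrobInfty W K 2 ℓ`.
* §1 `pairSupply_frobEqFrobInfty_of_Δ_neg` — the supply certifying `Φ ℓ := FrobEqFrobInfty W K 2 ℓ` (non-CM, `Δ < 0`, `d_K·(−|Δ|)` non-square,
  `ρ_{E,2^n}` onto).
* §2 `exists_frobEqFrobInfty_primitive_of_two_pow_pred_smul_ne_zero_of_Δ_neg` — on the multiplicative cut modulo Q2: one `s₀ ∈ Sel_(2^M)(E/ℚ)`
  with `2^{M₀−1} • s₀ ≠ 0` ⟹ a `FrobEqFrobInfty` Kolyvagin prime `ℓ` of index `≥ 2` and a datum of conductor `1·ℓ` with `P(ℓ) ∉ 2E(K[ℓ])`;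
  `kFourNeg_shape_of_two_pow_pred_smul_ne_zero` — K4Neg's conclusion VERBATIM in shape.
* §3 DEPTH ONE: `kFourNeg_shape_of_depth_le_one`, **`kFourNeg_conclusion_of_depth_one_of_hasMultiplicativeReductionAt`** — K4Neg's binders
  VERBATIM + `M₀ = 1` + one odd multiplicative prime ⟹ K4Neg's conclusion, modulo Q2 (= print 23091) ONLY: the `ℚ`-side twin of LEAD g23's
  `DEPTH-ONE-FIRST-BLOCK-g23.md`, with NO detection hypothesis (any non-zero class of `Sel₂(E/ℚ)` is the input; `#Sel₂(E) = 4` on the cell).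
* §4 LOSSLESS: `kFourNeg_shape_of_nonCMAtTwo_onCut` — leaf + GZ/L/GZK/Milne + Q2 ⟹ K4Neg's conclusion at every depth on the cut.

HONEST FRAMING: bookkeeping over the landed B₂ descent and gk2-p2's Čebotarev; reduces K4Neg to «B₂ over `ℚ` is sharp» and proves its depth-one
sub-cell modulo Q2; BSD is NOT proved by any of this.

References: [McCallumLMS1991] §5 Lemma 5.1, Lemma 5.3, Thm. 5.4; [Kolyvagin1989Izv] Thm. B₂, §3; [GrossLMS1991] §3 (3.1)–(3.3), §4 (4.4)–(4.6);
[GrossZagier1986] V.§2 (2.2); [Kramer1981] Thm. 1.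
-/

set_option autoImplicit false
-- the Theorems namespace of this sub repeats the summit name by design (D-0017 nested layout)
set_option linter.dupNamespace false

noncomputable section

open scoped Classical
open scoped AddSubgroup

namespace Summit.BirchSwinnertonDyer.BirchSwinnertonDyer.Theorems.GenusExact.PlusDescent

open WeierstrassCurve NumberField IsDedekindDomain Field Rat.HeightOneSpectrum Literature.NumberTheory.EllipticCurves
  Literature.NumberTheory.GaloisRepresentations Literature.NumberTheory.EllipticCurves.ModularForms AddSubgroup
  Literature.NumberTheory.EllipticCurves.RingClassField
open Summit.BirchSwinnertonDyer.BirchSwinnertonDyer.Rank1Residual (NonCMAtTwo)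
open Summit.BirchSwinnertonDyer.BirchSwinnertonDyer.Theses.GenusKolyvaginAtTwo
  (KolyvaginRelationAtTwo GrossZagierAllLevels EntireLFunctionRat MultPublishedInputsAtTwo MilneAnyModel)
open Summit.BirchSwinnertonDyer.Rank1Residual
open Summit.BirchSwinnertonDyer.BirchSwinnertonDyer.Theorems.GenusExact
open Summit.BirchSwinnertonDyer.BirchSwinnertonDyer.Theorems.GenusSupplyNarrow

/-! ## §1 The `Δ < 0` supply certifies `FrobEqFrobInfty W K 2 ℓ` -/

/-- Restriction of a `FrobEqFrobInfty` datum from `E[2^(n+1)]` to `E[2]`. [cite: GrossLMS1991, §3 (3.2)] -/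
theorem frobEqFrobInfty_two_of_two_pow_succ (W : WeierstrassCurve ℚ) (K : Type) [Field K] [NumberField K] {n ℓ : ℕ}
    (hF : FrobEqFrobInfty W K (2 ^ (n + 1)) ℓ) : FrobEqFrobInfty W K 2 ℓ := by
  obtain ⟨v, 𝔓, h, c₀, hℓv, h𝔓, hh, hc₀, hhP, hhK⟩ := hF
  refine ⟨v, 𝔓, h, c₀, hℓv, h𝔓, hh, hc₀, fun P ↦ ?_, hhK⟩
  have hle : geomTorsion W ((2 : ℕ) : ℤ) ≤ geomTorsion W ((2 ^ (n + 1) : ℕ) : ℤ) :=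
    geomTorsion_le_of_dvd W (by exact_mod_cast dvd_pow_self 2 (Nat.succ_ne_zero n))
  have h2 := congrArg Subtype.val (hhP ⟨(P : geomPoints W), hle P.2⟩)
  simp only [Literature.NumberTheory.EllipticCurves.AddSubgroup.torsionBy.coe_smul] at h2
  apply Subtype.ext
  simp only [Literature.NumberTheory.EllipticCurves.AddSubgroup.torsionBy.coe_smul]
  exact h2

/-- **The regular signed pair-Čebotarev supply on `Δ < 0`, CERTIFYING `FrobEqFrobInfty W K 2 ℓ`** (`E/ℚ` globally minimal, non-CM, `Δ < 0`,
`d_K·(−|Δ|)` non-square, `ρ_{E,2^n}` onto): gk2-p2's `FrobEqFrobInfty` pair Čebotarev `infinite_kolyvaginPrime_localization_fullOrder_pair` — a prime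
with `h = c₀` on `E[2^(n+1)]` and on `K` — read as the `Φ`-supply of the prime-clause-generic core with `Φ ℓ := FrobEqFrobInfty W K 2 ℓ`
(cf. `regularPairSupply_of_Δ_neg`, which forgets `h = c₀`). [cite: McCallumLMS1991, §3 Cor. 3.2] [cite: GrossLMS1991, §3 (3.1)–(3.3)] -/
theorem pairSupply_frobEqFrobInfty_of_Δ_neg (W : WeierstrassCurve ℚ) [W.IsElliptic] [W.IsGloballyMinimal] [NeZero (W.conductorNorm ℤ)]
    (hcm : ¬ W.HasCM) (hneg : W.Δ < 0) (K : Type) [Field K] [NumberField K] (hIQ : IsImaginaryQuadratic K)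
    (hsq1 : ¬ IsSquare ((NumberField.discr K : ℚ) * -|W.Δ|)) (hρ : ∀ n : ℕ, 0 < n → W.HasSurjectiveModNGaloisRep ((2 : ℤ) ^ n)) :
    ∀ (n : ℕ) (c : K ≃ₐ[ℚ] K), c ≠ 1 →
      ∀ (x y : galH1Torsion (W.baseChange K) ((2 ^ (n + 1) : ℕ) : ℤ)) (ex ey : ℕ), 1 ≤ ex → 1 ≤ ey →
      addOrderOf x = 2 ^ ex → addOrderOf y = 2 ^ ey →
      ∀ (sx sy : ℤ), (sx = 1 ∨ sx = -1) → (sy = 1 ∨ sy = -1) →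
      conjAct W c ((2 ^ (n + 1) : ℕ) : ℤ) x = sx • x → conjAct W c ((2 ^ (n + 1) : ℕ) : ℤ) y = sy • y →
      (∀ a b : ℤ, (∀ ρ ∈ torsionFixing (W.baseChange K) ((2 ^ (n + 1) : ℕ) : ℤ),
          h1Eval (W.baseChange K) ((2 ^ (n + 1) : ℕ) : ℤ) (a • x + b • y) ρ = 0) → a • x + b • y = 0) →
      ∃ ℓ : ℕ, Zhang2014.IsKolyvaginPrime (W.conductorNorm ℤ) W K 2 ℓ ∧ n + 1 ≤ Zhang2014.kolyvaginIndex W 2 ℓ ∧ FrobEqFrobInfty W K 2 ℓ ∧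
        (∃ (v : HeightOneSpectrum (𝓞 ℚ)) (𝔓 : Ideal (absIntegers (𝓞 ℚ) ℚ)) (h c₀ : absoluteGaloisGroup ℚ),
          (ℓ : 𝓞 ℚ) ∈ v.asIdeal ∧ 𝔓 ∈ v.primesAbove ∧ IsArithFrobAt (𝓞 ℚ) h 𝔓 ∧ IsComplexConjugation (Rat.castHom ℝ) c₀ ∧
          (∀ X : geomTorsion W ((2 ^ (n + 1) : ℕ) : ℤ), h • h • X = X) ∧
          (∃ u : geomTorsion W ((2 : ℕ) : ℤ), h • u ≠ u) ∧
          ∀ (e : K →ₐ[ℚ] AlgebraicClosure ℚ) (z : K), h • e z = c₀ • e z) ∧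
        ∀ w : HeightOneSpectrum (𝓞 K), (ℓ : 𝓞 K) ∈ w.asIdeal →
          (∀ j : ℕ, ((2 ^ j : ℕ) : ℤ) • x ∈ (W.baseChange K).torsionLocalKer (w.adicCompletion K) ((2 ^ (n + 1) : ℕ) : ℤ) ↔ ex ≤ j) ∧
          (∀ j : ℕ, ((2 ^ j : ℕ) : ℤ) • y ∈ (W.baseChange K).torsionLocalKer (w.adicCompletion K) ((2 ^ (n + 1) : ℕ) : ℤ) ↔ ey ≤ j) := by
  intro n c hc x y ex ey hex hey hx hy sx sy hsx hsy hτx hτy hres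
  have hsurN : ∀ m : ℕ, W.HasSurjectiveModNGaloisRep ((2 ^ m : ℕ) : ℤ) :=
    MinimalTwinBSDTwo.forall_hasSurjectiveModNGaloisRep_two_pow_of_pos W hρ
  have hρN : ∀ m : ℕ, W.HasSurjectiveModNGaloisRep (2 ^ m : ℕ) := fun m ↦ by exact_mod_cast hsurN m
  have hinf := infinite_kolyvaginPrime_localization_fullOrder_pair (W.conductorNorm ℤ) W hcm hneg K hIQ hsq1 hρN c hc (n + 1)
    (Nat.succ_pos n) x y hex hey hx hy hsx hsy hτx hτy hres
  obtain ⟨ℓ, hF, hkolZ, hidx, hloc⟩ := hinf.nonempty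
  refine ⟨ℓ, hkolZ, hidx, frobEqFrobInfty_two_of_two_pow_succ W K hF, ?_, hloc⟩
  obtain ⟨v, 𝔓, h, c₀, hℓv, h𝔓, hh, hc₀, hhP, hhK⟩ := hF
  obtain ⟨u, hu⟩ := KolyvaginEigenTwo.exists_twoTorsion_smul_ne_of_Δ_neg W hneg hc₀
  refine ⟨v, 𝔓, h, c₀, hℓv, h𝔓, hh, hc₀, fun X ↦ ?_, ?_, hhK⟩
  · rw [hhP, hhP, ← mul_smul, ← pow_two, hc₀.sq_eq_one, one_smul]
  · -- the moved `2`-torsion point lies in `E[2^(n+1)]`, where `h = c₀`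
    have hu2 : (u : geomPoints W) ∈ geomTorsion W ((2 : ℕ) : ℤ) := by
      rw [mem_geomTorsion_iff]
      have h2 := (mem_geomTorsion_iff W _ (u : geomPoints W)).mp u.2
      exact_mod_cast h2
    have huq : (u : geomPoints W) ∈ geomTorsion W ((2 ^ (n + 1) : ℕ) : ℤ) :=
      geomTorsion_le_of_dvd W (by exact_mod_cast dvd_pow_self 2 (Nat.succ_ne_zero n)) hu2
    refine ⟨⟨u, hu2⟩, fun heq ↦ hu ?_⟩
    have h1 := congrArg Subtype.val heq
    have h2 := congrArg Subtype.val (hhP ⟨u, huq⟩)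
    simp only [Literature.NumberTheory.EllipticCurves.AddSubgroup.torsionBy.coe_smul] at h1 h2
    apply Subtype.ext
    simp only [Literature.NumberTheory.EllipticCurves.AddSubgroup.torsionBy.coe_smul]
    rw [← h2]
    exact h1

/-! ## §2 K4Neg from one Selmer class of order `2^{M₀}` over `ℚ` -/

/-- **B2Q♭ for K4Neg, `FrobEqFrobInfty` verbatim, on the multiplicative cut modulo Q2**: `E/ℚ` globally minimal, non-CM, `Δ < 0`, odd Tamagawa
product, an odd multiplicative prime `v`, `ρ_{E,2^n}` onto; `K` imaginary quadratic, `d_K` odd `≠ −3`, Heegner, the two Theorem-B₂ non-squares;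
`d₁` with `2^{M₀+1} ∤ P(1)`; `w(E) = +1`.  **One `s₀ ∈ Sel_(2^M)(E/ℚ)` with `2^{M₀−1} • s₀ ≠ 0` yields a Zhang–Kolyvagin prime `ℓ` at `2` of index
`≥ 2` with `FrobEqFrobInfty W K 2 ℓ` and a `d₁`-compatible datum of conductor `1·ℓ` with `P(1·ℓ) ∉ 2E(K[1·ℓ])`.**  BSD is NOT proved by this.
[cite: McCallumLMS1991, §5 Lemma 5.3, Thm. 5.4] [cite: Kolyvagin1989Izv, Thm. B₂, §3] -/
theorem exists_frobEqFrobInfty_primitive_of_two_pow_pred_smul_ne_zero_of_Δ_neg (hQ2 : KolyvaginRelationAtTwo)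
    (W : WeierstrassCurve ℚ) [W.IsElliptic] [W.IsGloballyMinimal] [NeZero (W.conductorNorm ℤ)] (hcm : ¬ W.HasCM) (hneg : W.Δ < 0)
    (hT : Odd W.tamagawaProduct) (v : HeightOneSpectrum (𝓞 ℚ)) (h2v : ((2 : ℕ) : 𝓞 ℚ) ∉ v.asIdeal)
    (hNv : ((W.conductorNorm ℤ : ℕ) : 𝓞 ℚ) ∈ v.asIdeal) (hmult : W.HasMultiplicativeReductionAt v)
    (K : Type) [Field K] [NumberField K] (hIQ : IsImaginaryQuadratic K) (hodd : Odd (NumberField.discr K))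
    (h3 : NumberField.discr K ≠ -3) (hHe : SatisfiesHeegnerHypothesis (W.conductorNorm ℤ) K)
    (hsq1 : ¬ IsSquare ((NumberField.discr K : ℚ) * -|W.Δ|)) (hsq2 : ¬ IsSquare ((NumberField.discr K : ℚ) * (-(2 * |W.Δ|))))
    (hρ : ∀ n : ℕ, 0 < n → W.HasSurjectiveModNGaloisRep ((2 : ℤ) ^ n))
    (Dt : ModularParametrizationData W (W.conductorNorm ℤ)) (β : ℤ) (ι : K →+* ℂ) (d₁ : KolyvaginHeegnerData Dt β ι 1) (M₀ : ℕ)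
    (hndiv : ¬ ∃ Q : (W.baseChange (ringClassField K ι 1)).toAffine.Point, ((2 ^ (M₀ + 1) : ℕ) : ℤ) • Q = d₁.derivedPoint)
    (hw1 : W.rootNumber = 1)
    (M : ℕ) (s₀ : galH1Torsion W ((2 ^ M : ℕ) : ℤ)) (hs₀ : s₀ ∈ selmerGroup W ((2 ^ M : ℕ) : ℤ))
    (hne : ((2 ^ (M₀ - 1) : ℕ) : ℤ) • s₀ ≠ 0) :
    ∃ (ℓ : ℕ) (d : KolyvaginHeegnerData Dt β ι (1 * ℓ)),
      Zhang2014.IsKolyvaginPrime (W.conductorNorm ℤ) W K 2 ℓ ∧ 2 ≤ Zhang2014.kolyvaginIndex W 2 ℓ ∧ FrobEqFrobInfty W K 2 ℓ ∧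
      (∀ s ∈ d₁.S, ∃ s' ∈ d.S, ∀ (x : ringClassField K ι 1) (x' : ringClassField K ι (1 * ℓ)),
          (x : ℂ) = x' → ((s' x' : ringClassField K ι (1 * ℓ)) : ℂ) = (s x : ℂ)) ∧
      (∀ (x : ringClassField K ι 1) (x' : ringClassField K ι (1 * ℓ)), (x : ℂ) = x' → d.emb x' = d₁.emb x) ∧
      ¬ ∃ Q : (W.baseChange (ringClassField K ι (1 * ℓ))).toAffine.Point, (2 : ℤ) • Q = d.derivedPoint := by
  haveI : Fact (Nat.Prime 2) := ⟨Nat.prime_two⟩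
  have hN : (W.conductorNorm ℤ) ≠ 0 := NeZero.ne _
  have hs2 : W.HasSurjectiveModNGaloisRep 2 := by simpa using hρ 1 one_pos
  have hNPh : ∀ (L : ℕ), 1 ≤ L → ∀ z : galH1Torsion (W.baseChange K) ((2 ^ L : ℕ) : ℤ),
      (∀ ρ' ∈ torsionFixing (W.baseChange K) ((2 ^ L : ℕ) : ℤ), h1Eval (W.baseChange K) ((2 ^ L : ℕ) : ℤ) z ρ' = 0) →
      (∀ w : HeightOneSpectrum (𝓞 K), z ∈ selmerLocalKer (W.baseChange K) (w.adicCompletion K) ((2 ^ L : ℕ) : ℤ)) → z = 0 :=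
    fun L hL z hz hzS ↦ NonPhantomPow.nonPhantomAtTwo_of_hasMultiplicativeReductionAt (W := W) (K := K) hT hρ hIQ hodd hsq1 hsq2 hN hHe
      h2v hNv hmult L hL z hz (fun w _ ↦ hzS w)
  -- move `s₀` up to level `2^(M + M₀ + 1) ≥ 2^(M₀ + 1)`
  have hdvd : ((2 ^ M : ℕ) : ℤ) ∣ ((2 ^ (M + M₀ + 1) : ℕ) : ℤ) := natCast_pow_dvd_natCast_pow (p := 2) (by omega)
  have hinj : Function.Injective (torsionH1OfDvd W hdvd) :=
    VisiblePairAtTwo.torsionH1OfDvd_pow_injective W (p := 2) (VisiblePairAtTwo.torsionBy_two_eq_bot_of_surj W hs2) hdvd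
  have hs₀' : torsionH1OfDvd W hdvd s₀ ∈ selmerGroup W ((2 ^ (M + M₀ + 1) : ℕ) : ℤ) := torsionH1OfDvd_mem_selmerGroup W hdvd hs₀
  have hne' : ((2 ^ (M₀ - 1) : ℕ) : ℤ) • torsionH1OfDvd W hdvd s₀ ≠ 0 := fun h ↦
    hne (hinj (by rw [map_zsmul, map_zero, h]))
  obtain ⟨ℓ, d, hkol, hidx, hΦ, -, hS, hemb, hwit⟩ :=
    exists_primitive_of_two_pow_pred_smul_ne_zero_of_nonPhantom_of_pairSupply (fun ℓ ↦ FrobEqFrobInfty W K 2 ℓ) hQ2 W hcm hT K hIQ hodd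
      h3 hHe hρ hNPh Dt β ι d₁ M₀ hndiv hw1 (pairSupply_frobEqFrobInfty_of_Δ_neg W hcm hneg K hIQ hsq1 hρ) (M + M₀ + 1) (by omega) _ hs₀' hne'
  exact ⟨ℓ, d, hkol, le_trans (by omega) hidx, hΦ, hS, hemb, hwit⟩

/-- **THE K4Neg SHAPE.**  On the same frame, from ONE class `s₀ ∈ Sel_(2^M)(E/ℚ)` with `2^{M₀−1} • s₀ ≠ 0`: the CONCLUSION of the route item
`K4Neg` (stmt-31526) VERBATIM in shape — `∃ n` square-free (here `n = 1·ℓ`), `∃ d : KolyvaginHeegnerData Dt β ι n`, every `ℓ ∣ n` a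
Zhang–Kolyvagin prime at `2` of index `≥ 2` with `FrobEqFrobInfty W K 2 ℓ`, and `P(n) ∉ 2E(K[n])`.  So K₄ is implied, modulo Q2 on the cut, by
«`Sel_(2^∞)(E/ℚ)` has a class of order `2^{M₀}`».  BSD is NOT proved by this; K4Neg is NOT proved by this. [cite: McCallumLMS1991, §5 Thm. 5.4]
[cite: Kolyvagin1989Izv, Thm. B₂] -/
theorem kFourNeg_shape_of_two_pow_pred_smul_ne_zero (hQ2 : KolyvaginRelationAtTwo)
    (W : WeierstrassCurve ℚ) [W.IsElliptic] [W.IsGloballyMinimal] [NeZero (W.conductorNorm ℤ)] (hcm : ¬ W.HasCM) (hneg : W.Δ < 0)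
    (hT : Odd W.tamagawaProduct) (v : HeightOneSpectrum (𝓞 ℚ)) (h2v : ((2 : ℕ) : 𝓞 ℚ) ∉ v.asIdeal)
    (hNv : ((W.conductorNorm ℤ : ℕ) : 𝓞 ℚ) ∈ v.asIdeal) (hmult : W.HasMultiplicativeReductionAt v)
    (K : Type) [Field K] [NumberField K] (hIQ : IsImaginaryQuadratic K) (hodd : Odd (NumberField.discr K))
    (h3 : NumberField.discr K ≠ -3) (hHe : SatisfiesHeegnerHypothesis (W.conductorNorm ℤ) K)
    (hsq1 : ¬ IsSquare ((NumberField.discr K : ℚ) * -|W.Δ|)) (hsq2 : ¬ IsSquare ((NumberField.discr K : ℚ) * (-(2 * |W.Δ|))))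
    (hρ : ∀ n : ℕ, 0 < n → W.HasSurjectiveModNGaloisRep ((2 : ℤ) ^ n))
    (Dt : ModularParametrizationData W (W.conductorNorm ℤ)) (β : ℤ) (ι : K →+* ℂ) (d₁ : KolyvaginHeegnerData Dt β ι 1) (M₀ : ℕ)
    (hndiv : ¬ ∃ Q : (W.baseChange (ringClassField K ι 1)).toAffine.Point, ((2 ^ (M₀ + 1) : ℕ) : ℤ) • Q = d₁.derivedPoint)
    (hw1 : W.rootNumber = 1)
    (hsharp : ∃ (M : ℕ) (s₀ : galH1Torsion W ((2 ^ M : ℕ) : ℤ)), s₀ ∈ selmerGroup W ((2 ^ M : ℕ) : ℤ) ∧ ((2 ^ (M₀ - 1) : ℕ) : ℤ) • s₀ ≠ 0) :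
    ∃ (n : ℕ) (d : KolyvaginHeegnerData Dt β ι n), Squarefree n ∧
      (∀ ℓ ∈ n.primeFactors, Zhang2014.IsKolyvaginPrime (W.conductorNorm ℤ) W K 2 ℓ ∧ 2 ≤ Zhang2014.kolyvaginIndex W 2 ℓ ∧
        FrobEqFrobInfty W K 2 ℓ) ∧
      ¬ ∃ Q : (W.baseChange (ringClassField K ι n)).toAffine.Point, (2 : ℤ) • Q = d.derivedPoint := by
  obtain ⟨M, s₀, hs₀, hne⟩ := hsharp
  obtain ⟨ℓ, d, hkol, hidx, hF, -, -, hwit⟩ :=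
    exists_frobEqFrobInfty_primitive_of_two_pow_pred_smul_ne_zero_of_Δ_neg hQ2 W hcm hneg hT v h2v hNv hmult K hIQ hodd h3 hHe hsq1 hsq2 hρ Dt
      β ι d₁ M₀ hndiv hw1 M s₀ hs₀ hne
  have hℓp : ℓ.Prime := hkol.1
  refine ⟨1 * ℓ, d, by rw [one_mul]; exact hℓp.squarefree, fun q hq ↦ ?_, hwit⟩
  rw [one_mul, hℓp.primeFactors, Finset.mem_singleton] at hq
  subst hq
  exact ⟨hkol, hidx, hF⟩

/-! ## §3 DEPTH ONE for K4Neg, modulo Q2 -/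

/-- **DEPTH ONE (`M₀ ≤ 1`): K₄ HOLDS AT A SINGLE `FrobEqFrobInfty` PRIME, modulo Q2, on the multiplicative cut.**  If `4 ∤ P(1)` and
`1 < #Sel₂(E/ℚ)` (the K₄ cell has `4`), ANY non-zero `s₀ ∈ Sel₂(E/ℚ)` is the input of §2 with `M₀ = 1`: the conclusion of K4Neg (shape verbatim)
is a THEOREM modulo Q2 (= print 23091) on the depth-one sub-cell — `ℚ`-side twin of LEAD g23's `DEPTH-ONE-FIRST-BLOCK-g23.md`, without DET.
BSD is NOT proved by this; K4Neg (all depths) is NOT closed by this. [cite: McCallumLMS1991, §5 Thm. 5.4] [cite: Kolyvagin1989Izv, Thm. B₂, §3] -/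
theorem kFourNeg_shape_of_depth_le_one (hQ2 : KolyvaginRelationAtTwo)
    (W : WeierstrassCurve ℚ) [W.IsElliptic] [W.IsGloballyMinimal] [NeZero (W.conductorNorm ℤ)] (hcm : ¬ W.HasCM) (hneg : W.Δ < 0)
    (hT : Odd W.tamagawaProduct) (v : HeightOneSpectrum (𝓞 ℚ)) (h2v : ((2 : ℕ) : 𝓞 ℚ) ∉ v.asIdeal)
    (hNv : ((W.conductorNorm ℤ : ℕ) : 𝓞 ℚ) ∈ v.asIdeal) (hmult : W.HasMultiplicativeReductionAt v)
    (K : Type) [Field K] [NumberField K] (hIQ : IsImaginaryQuadratic K) (hodd : Odd (NumberField.discr K))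
    (h3 : NumberField.discr K ≠ -3) (hHe : SatisfiesHeegnerHypothesis (W.conductorNorm ℤ) K)
    (hsq1 : ¬ IsSquare ((NumberField.discr K : ℚ) * -|W.Δ|)) (hsq2 : ¬ IsSquare ((NumberField.discr K : ℚ) * (-(2 * |W.Δ|))))
    (hρ : ∀ n : ℕ, 0 < n → W.HasSurjectiveModNGaloisRep ((2 : ℤ) ^ n))
    (Dt : ModularParametrizationData W (W.conductorNorm ℤ)) (β : ℤ) (ι : K →+* ℂ) (d₁ : KolyvaginHeegnerData Dt β ι 1)
    (hndiv : ¬ ∃ Q : (W.baseChange (ringClassField K ι 1)).toAffine.Point, ((2 ^ (1 + 1) : ℕ) : ℤ) • Q = d₁.derivedPoint)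
    (hw1 : W.rootNumber = 1) (hSel : 1 < Nat.card (W.selmerGroup 2)) :
    ∃ (n : ℕ) (d : KolyvaginHeegnerData Dt β ι n), Squarefree n ∧
      (∀ ℓ ∈ n.primeFactors, Zhang2014.IsKolyvaginPrime (W.conductorNorm ℤ) W K 2 ℓ ∧ 2 ≤ Zhang2014.kolyvaginIndex W 2 ℓ ∧
        FrobEqFrobInfty W K 2 ℓ) ∧
      ¬ ∃ Q : (W.baseChange (ringClassField K ι n)).toAffine.Point, (2 : ℤ) • Q = d.derivedPoint := by
  have hSel' : 1 < Nat.card (selmerGroup W ((2 ^ 1 : ℕ) : ℤ)) := by rw [pow_one, Nat.cast_ofNat]; exact hSel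
  have hbot : selmerGroup W ((2 ^ 1 : ℕ) : ℤ) ≠ ⊥ := fun h ↦ by rw [h, AddSubgroup.card_bot] at hSel'; exact lt_irrefl _ hSel'
  obtain ⟨⟨s₀, hs₀⟩, hne⟩ := AddSubgroup.ne_bot_iff_exists_ne_zero.mp hbot
  have hne' : ((2 ^ (1 - 1) : ℕ) : ℤ) • s₀ ≠ 0 := by
    rw [Nat.sub_self, pow_zero, Nat.cast_one, one_zsmul]
    rintro rfl
    exact hne (Subtype.ext rfl)
  exact kFourNeg_shape_of_two_pow_pred_smul_ne_zero hQ2 W hcm hneg hT v h2v hNv hmult K hIQ hodd h3 hHe hsq1 hsq2 hρ Dt β ι d₁ 1 hndiv hw1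
    ⟨1, s₀, hs₀, hne'⟩

/-- **K4Neg ON ITS DEPTH-ONE SUB-CELL, modulo Q2 and one odd multiplicative prime** — the item's binders VERBATIM (habitat, `Δ < 0`, `#Sel₂(E) = 4`,
prime Heegner frame, odd-Manin datum, `2^{M₀} ∥ P(1)`, Sel₂-minimal rank-`1` twin with `ord₂ C(Wd) ≤ 1`) PLUS `M₀ = 1` and a multiplicative prime
`v ∤ 2` of `E`: the conclusion of K4Neg.  (`w(E) = +1` from `r_an(E) = 0`; most binders idle, displayed for by-name use.)  BSD is NOT proved by this;
K4Neg (all depths) is NOT closed by this. [cite: McCallumLMS1991, §5 Thm. 5.4] [cite: Kolyvagin1989Izv, Thm. B₂] -/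
theorem kFourNeg_conclusion_of_depth_one_of_hasMultiplicativeReductionAt (hQ2 : KolyvaginRelationAtTwo)
    (W : WeierstrassCurve ℚ) [W.IsElliptic] [W.IsGloballyMinimal] [NeZero (W.conductorNorm ℤ)] (hcm : ¬ W.HasCM) (hr0 : W.analyticRank = 0)
    (hρ : ∀ n : ℕ, 0 < n → W.HasSurjectiveModNGaloisRep ((2 : ℤ) ^ n)) (hT : Odd W.tamagawaProduct) (hneg : W.Δ < 0)
    (h4 : Nat.card (W.selmerGroup 2) = 4)
    (v : HeightOneSpectrum (𝓞 ℚ)) (h2v : ((2 : ℕ) : 𝓞 ℚ) ∉ v.asIdeal) (hNv : ((W.conductorNorm ℤ : ℕ) : 𝓞 ℚ) ∈ v.asIdeal)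
    (hmult : W.HasMultiplicativeReductionAt v)
    (K : Type) [Field K] [NumberField K] (hIQ : IsImaginaryQuadratic K) (hodd : Odd (NumberField.discr K))
    (h3 : NumberField.discr K ≠ -3) (hHe : SatisfiesHeegnerHypothesis (W.conductorNorm ℤ) K)
    (hsq1 : ¬ IsSquare ((NumberField.discr K : ℚ) * -|W.Δ|)) (hsq2 : ¬ IsSquare ((NumberField.discr K : ℚ) * (-(2 * |W.Δ|))))
    (ℓ₀ : ℕ) (_hℓ₀ : ℓ₀.Prime) (_hdK : NumberField.discr K = -(ℓ₀ : ℤ))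
    (_h2K : ((Ideal.span {(2 : ℤ)}).primesOver (NumberField.RingOfIntegers K)).ncard = 2)
    (Dt : ModularParametrizationData W (W.conductorNorm ℤ))
    (_hopt : ∀ z ∈ Dt.L.lattice, ∃ w ∈ periodLattice Dt.f, z = (Dt.c : ℂ) * w) (_hc : Odd Dt.c)
    (β : ℤ) (ι : K →+* ℂ) (d₁ : KolyvaginHeegnerData Dt β ι 1) (_hy : ¬ IsOfFinAddOrder d₁.derivedPoint) (M₀ : ℕ)
    (_hdiv : ∃ Q : (W.baseChange (ringClassField K ι 1)).toAffine.Point, ((2 ^ M₀ : ℕ) : ℤ) • Q = d₁.derivedPoint)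
    (hndiv : ¬ ∃ Q : (W.baseChange (ringClassField K ι 1)).toAffine.Point, ((2 ^ (M₀ + 1) : ℕ) : ℤ) • Q = d₁.derivedPoint)
    (hM₀ : M₀ = 1)
    (Wd : WeierstrassCurve ℚ) [Wd.IsElliptic] [Wd.IsGloballyMinimal]
    (_hWd : ∃ C : VariableChange ℚ, C • W.quadraticTwist (NumberField.discr K : ℚ) = Wd) (_hrd : Wd.analyticRank = 1)
    (_hSelWd : Nat.card (Wd.selmerGroup 2) = 2) (_hTam : padicValNat 2 Wd.tamagawaProduct ≤ 1) :
    ∃ (n : ℕ) (d : KolyvaginHeegnerData Dt β ι n), Squarefree n ∧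
      (∀ ℓ ∈ n.primeFactors, Zhang2014.IsKolyvaginPrime (W.conductorNorm ℤ) W K 2 ℓ ∧ 2 ≤ Zhang2014.kolyvaginIndex W 2 ℓ ∧
        FrobEqFrobInfty W K 2 ℓ) ∧
      ¬ ∃ Q : (W.baseChange (ringClassField K ι n)).toAffine.Point, (2 : ℤ) • Q = d.derivedPoint := by
  subst hM₀
  have hw : W.rootNumber = 1 :=
    (Literature.Barriers.BirchSwinnertonDyer.even_analyticRank_iff_of_isNewformOf_conductorLevel Dt.isNewformOf).mp
      (by rw [hr0]; exact Even.zero)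
  exact kFourNeg_shape_of_depth_le_one hQ2 W hcm hneg hT v h2v hNv hmult K hIQ hodd h3 hHe hsq1 hsq2 hρ Dt β ι d₁ hndiv hw (by rw [h4]; norm_num)

/-! ## §4 K4Neg is LOSSLESS on the cut -/

/-- **K₄ IS LOSSLESS ON THE CUT (`FrobEqFrobInfty` verbatim).**  At a Δ<0 supply frame of the habitat with an odd multiplicative prime (non-CM,
`r_an = 0`, `ρ_{E,2^n}` onto, odd Tamagawa; `K` frame with the two B₂ non-squares; odd-Manin `Dt`; `2^(M₀) ∥ P(1)`, `M₀ ≥ 1`; globally minimal twin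
of analytic rank `1` with `#Sel₂(Wd) = 2`, `ord₂ C(Wd) ≤ 1`): the leaf `NonCMAtTwo`, the four PRINT items and Q2 imply the conclusion of K4Neg.
(g34 Lossless: `#Ш(E/K)[2^∞] = 4^(M₀)`; no witness ⟹ B2Q♭ ⟹ `2^(M₀−1) · Ш(E/ℚ)[2^∞] = 0` ⟹ decoupled sandwich ⟹ `#Ш(E/K)[2^∞] ∣ 4^(M₀−1)`, absurd.)
CONDITIONAL on the leaf; BSD is NOT proved by this; K4Neg is NOT proved by this. [cite: McCallumLMS1991, §5 Thm. 5.4] [cite: GrossZagier1986, V.§2 (2.2)]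
[cite: Kramer1981, Thm. 1] -/
theorem kFourNeg_shape_of_nonCMAtTwo_onCut
    (hleaf : NonCMAtTwo) (hGZ : GrossZagierAllLevels) (hL : EntireLFunctionRat) (hGZK : MultPublishedInputsAtTwo) (hMi : MilneAnyModel)
    (hQ2 : KolyvaginRelationAtTwo)
    (W : WeierstrassCurve ℚ) [W.IsElliptic] [W.IsGloballyMinimal] [NeZero (W.conductorNorm ℤ)] (hcm : ¬ W.HasCM) (hr0 : W.analyticRank = 0)
    (hρ : ∀ n : ℕ, 0 < n → W.HasSurjectiveModNGaloisRep ((2 : ℤ) ^ n)) (hT : Odd W.tamagawaProduct) (hneg : W.Δ < 0)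
    (v : HeightOneSpectrum (𝓞 ℚ)) (h2v : ((2 : ℕ) : 𝓞 ℚ) ∉ v.asIdeal) (hNv : ((W.conductorNorm ℤ : ℕ) : 𝓞 ℚ) ∈ v.asIdeal)
    (hmult : W.HasMultiplicativeReductionAt v)
    (K : Type) [Field K] [NumberField K] (hIQ : IsImaginaryQuadratic K) (hodd : Odd (NumberField.discr K))
    (h3 : NumberField.discr K ≠ -3) (hHe : SatisfiesHeegnerHypothesis (W.conductorNorm ℤ) K)
    (hsq1 : ¬ IsSquare ((NumberField.discr K : ℚ) * -|W.Δ|)) (hsq2 : ¬ IsSquare ((NumberField.discr K : ℚ) * (-(2 * |W.Δ|))))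
    (Dt : ModularParametrizationData W (W.conductorNorm ℤ)) (hc : Odd Dt.c) (β : ℤ) (ι : K →+* ℂ) (d₁ : KolyvaginHeegnerData Dt β ι 1)
    (hy : ¬ IsOfFinAddOrder d₁.derivedPoint) (M₀ : ℕ)
    (hdiv : ∃ Q : (W.baseChange (ringClassField K ι 1)).toAffine.Point, ((2 ^ M₀ : ℕ) : ℤ) • Q = d₁.derivedPoint)
    (hndiv : ¬ ∃ Q : (W.baseChange (ringClassField K ι 1)).toAffine.Point, ((2 ^ (M₀ + 1) : ℕ) : ℤ) • Q = d₁.derivedPoint)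
    (hM₀ : 1 ≤ M₀)
    (Wd : WeierstrassCurve ℚ) [Wd.IsElliptic] [Wd.IsGloballyMinimal]
    (hWd : ∃ C : VariableChange ℚ, C • W.quadraticTwist (NumberField.discr K : ℚ) = Wd) (hrd : Wd.analyticRank = 1)
    (hSel : Nat.card (Wd.selmerGroup 2) = 2) (hTam : padicValNat 2 Wd.tamagawaProduct ≤ 1) :
    ∃ (n : ℕ) (d : KolyvaginHeegnerData Dt β ι n), Squarefree n ∧
      (∀ ℓ ∈ n.primeFactors, Zhang2014.IsKolyvaginPrime (W.conductorNorm ℤ) W K 2 ℓ ∧ 2 ≤ Zhang2014.kolyvaginIndex W 2 ℓ ∧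
        FrobEqFrobInfty W K 2 ℓ) ∧
      ¬ ∃ Q : (W.baseChange (ringClassField K ι n)).toAffine.Point, (2 : ℤ) • Q = d.derivedPoint := by
  haveI : Fact (Nat.Prime 2) := ⟨Nat.prime_two⟩
  have hρ2 : W.HasSurjectiveModNGaloisRep 2 := by simpa using hρ 1 one_pos
  have hw : W.rootNumber = 1 :=
    (Literature.Barriers.BirchSwinnertonDyer.even_analyticRank_iff_of_isNewformOf_conductorLevel Dt.isNewformOf).mp
      (by rw [hr0]; exact Even.zero)
  have hrk0 : W.mordellWeilRank = 0 := by rw [(hGZK W (by rw [hr0]; exact zero_le_one)).1, hr0]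
  have hpow := Lossless.natCard_primaryComponent_sha_baseChange_two_eq_pow_of_nonCMAtTwo hleaf hGZ hL hGZK hMi W hcm hρ2 hT hr0 K hIQ
    hodd h3 hHe Dt hc β ι d₁ M₀ hdiv hndiv Wd hWd hrd
  by_contra hno
  have hB2Q : ∀ (k : ℕ) (a : W.galH1), a ∈ W.sha → ((2 ^ k : ℕ) : ℤ) • a = 0 → ((2 ^ (M₀ - 1) : ℕ) : ℤ) • a = 0 := by
    intro k a ha hka
    by_contra hne
    rcases Nat.eq_zero_or_pos k with rfl | hkpos
    · rw [pow_zero, Nat.cast_one, one_zsmul] at hka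
      exact hne (by rw [hka, zsmul_zero])
    · have hn : ((2 ^ k : ℕ) : ℤ) ≠ 0 := by positivity
      have hmem : a ∈ W.sha ⊓ torsionBy W.galH1 ((2 ^ k : ℕ) : ℤ) :=
        AddSubgroup.mem_inf.mpr ⟨ha, by change ((2 ^ k : ℕ) : ℤ) • a = 0; exact hka⟩
      rw [← WeierstrassCurve.map_torsionH1ToH1_selmerGroup_holds W hn] at hmem
      obtain ⟨x, hx, rfl⟩ := AddSubgroup.mem_map.mp hmem
      have hne' : ((2 ^ (M₀ - 1) : ℕ) : ℤ) • x ≠ 0 := fun h ↦ hne (by rw [← map_zsmul, h, map_zero])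
      exact hno (kFourNeg_shape_of_two_pow_pred_smul_ne_zero hQ2 W hcm hneg hT v h2v hNv hmult K hIQ hodd h3 hHe hsq1 hsq2 hρ Dt β ι d₁ M₀
        hndiv hw ⟨k, x, hx, hne'⟩)
  have hdvd := Lossless.natCard_primaryComponent_sha_baseChange_two_dvd_pow_of_shaExponent W K hT hIQ hodd hHe hρ2 Dt β ι d₁ hy M₀ hndiv hw
    hrk0 Wd hWd hSel (Or.inl ⟨hneg, hTam⟩) hB2Q
  rw [hpow] at hdvd
  have hle : 2 * M₀ ≤ 2 * (M₀ - 1) := (Nat.pow_dvd_pow_iff_le_right (by norm_num : 1 < 2)).mp hdvd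
  omega

end Summit.BirchSwinnertonDyer.BirchSwinnertonDyer.Theorems.GenusExact.PlusDescent

end
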